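import Literature.Probability.LatticeModels.LayeredPlaneRotatorDecoupling
import Literature.Probability.LatticeModels.PlaneRotatorShellDecay
import HarnessLib

/-!
# Strand decoupling for the classical XY chain array on `ℤ³`: a single-chain susceptibility ceiling `χ₁` turns
# into exponential decay ACROSS the chains — `⟨cos(θ_a − θ_c)⟩_Λ ≤ (2βJ⊥ χ₁)^{d⊥(a,c)}`

Topic `Literature/Probability/LatticeModels`. The classical mechanism behind the quasi-ONE-dimensional ordering of
weakly coupled chains (Scalapino–Imry–Pincus, Phys. Rev. B 11 (1975) 2042: `k_BT_c ≈ zJ⊥χ_{1D}(T_c)`), in the rigorous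
ONE-SIDED direction: an array of XY chains (coupling `J∥` along the chains, `J⊥` to the `4` neighbouring chains) has
no transverse order at inverse temperature `β` as soon as `2βJ⊥ χ₁ < 1`, `χ₁` a uniform ceiling on the
susceptibility of ONE isolated chain — so the three-dimensional ordering temperature obeys
`k_BT_c ≤ inf{T : 2J⊥χ₁(J∥/T) < T}`, which tends to `0` as `J⊥ → 0` because `χ₁(K)` is finite for every `K`
(`PlaneRotatorChainTwoPoint.lean`: `χ₁ ≤ (1+u)/(1−u)`, `u = I₁/I₀`). This is the 1D → 3D sibling of the layer
decoupling `twoPoint_layered_le_pow_interlayer'` (`LayeredPlaneRotatorDecoupling.lean`, 2D → 3D), with the SAME tree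
object read the other way: `layeredXYCoupling β Jp Jz Λ` with the STRONG coupling `Jz = J∥` along the stacking axis
(the chains) and the WEAK in-plane coupling `Jp = J⊥` (between chains). Ingredients, all from the tree:

* the Lieb–Rivasseau separating inequality (E. H. Lieb, Comm. Math. Phys. 77 (1980) 127, eq. (23) [Lieb1980];
  V. Rivasseau, ibid. 145; tree theorem `liebRivasseauInequality_holds`) with Lieb's inside system = the bonds
  TOUCHING the chain of `a` (its axial bonds plus the transverse bonds DANGLING to the free rotators of the four
  neighbouring chains) and separating set = the four neighbouring chains;
* Aizenman–Simon's local Ward bound in the leaf form `twoPoint_add_leaf_le` [AizenmanSimon1980LocalWard];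
* Simon's iteration with a floor distance, `decay_of_shellBound` (`PlaneRotatorShellDecay.lean`) [Simon1980CMP],
  here with the transverse `ℓ¹` distance between chains.

Contents: `strand` (the transverse label `(x₀, x₁)` of a site), `onStrand` / `touchingStrand` / `crossingStrand` /
`untouchingStrand` (the bond classes), `axialFootAt` (the foot of a transverse bond on a given chain),
`sum_crossingStrand_le` (transverse coordination `≤ 4βJ⊥`), `twoPoint_touchingStrand_le` (one-chain transfer
bound), `liebRivasseau_strand` (the separating-inequality instance) and the main statement

  **`twoPoint_layered_le_pow_transverse`**: for `β, Jp, Jz ≥ 0`, any `χ` with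
  `∑_{x ∈ chain(a)} ⟨cos(θ_a − θ_x)⟩^{1D}_{chain(a)} ≤ χ` for all `a`, and all `a, c ∈ Λ`:
  `⟨cos(θ_a − θ_c)⟩_{Λ} ≤ (2βJp χ)^{|a₀ − c₀| + |a₁ − c₁|}`.

HONEST FRAMING: classical rotators in finite volume (free boundary conditions), upper bounds only; the cell
`pub/hubbard-tc` (MO-S3) reads it, under its modelling key K5, as the back-end «certified single-chain word ⇒
ceiling on the 3D ordering temperature of weakly coupled chains / ladders» (hold-out M38, (Sr,Ca)₁₄Cu₂₄O₄₁); it is not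
a statement about quantum ladders, spin gaps or superconductivity.
-/

noncomputable section

open MeasureTheory Finset
open scoped BigOperators

namespace Literature.Probability.LatticeModels

namespace PlaneRotator

section StrandsZ3

open Literature.Barriers.CriticalPhenomena Literature.Barriers.CriticalPhenomena.LongRangeIsing

variable {Λ : Finset (Site 3)}

/-! ### Strands (chains along the stacking axis), their bond classes and transverse feet -/

/-- The **strand** (transverse label) of a site of `Λ ⊂ ℤ³`: its two in-plane coordinates; the sites with a given
strand form one chain along the stacking axis. [cite: Lieb1980, eqs. (4)–(5) (choice of the inside system A)] -/
def strand (x : Λ) : ℤ × ℤ := ((x : Site 3) 0, (x : Site 3) 1)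

/-- The transverse `ℓ¹` distance between the strands of two sites. [cite: Simon1980CMP, Thm 1.3 (g(γ), decay in a distance)] -/
def strandDist (x y : Λ) : ℕ := ((strand x).1 - (strand y).1).natAbs + ((strand x).2 - (strand y).2).natAbs

/-- The **axial couplings of the strand `s`**: `J` restricted to ordered pairs with both ends on `s` — the strictly
one-dimensional chain of that strand, all other rotators free. [cite: Lieb1980, eqs. (4)–(5) (H_A)] -/
def onStrand (J : Λ × Λ → ℝ) (s : ℤ × ℤ) (p : Λ × Λ) : ℝ :=
  if strand p.1 = s ∧ strand p.2 = s then J p else 0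

/-- The **bonds touching the strand `s`** (at least one end on `s`): Lieb's inside system for the separating set
formed by the neighbouring strands. [cite: Lieb1980, eqs. (4)–(5) (H_A)] -/
def touchingStrand (J : Λ × Λ → ℝ) (s : ℤ × ℤ) (p : Λ × Λ) : ℝ :=
  if strand p.1 = s ∨ strand p.2 = s then J p else 0

/-- The **crossing (transverse) bonds of the strand `s`**: exactly one end on `s`. [cite: Lieb1980, eqs. (4)–(5)] -/
def crossingStrand (J : Λ × Λ → ℝ) (s : ℤ × ℤ) (p : Λ × Λ) : ℝ :=
  if (strand p.1 = s ∧ strand p.2 ≠ s) ∨ (strand p.1 ≠ s ∧ strand p.2 = s) then J p else 0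

/-- The **bonds not touching the strand `s`**: Lieb's outside Hamiltonian `H_C`. [cite: Lieb1980, eqs. (4)–(5) (H_{A+C} = H_A + H_C)] -/
def untouchingStrand (J : Λ × Λ → ℝ) (s : ℤ × ℤ) (p : Λ × Λ) : ℝ :=
  if strand p.1 = s ∨ strand p.2 = s then 0 else J p

/-- `touchingStrand = onStrand + crossingStrand`. [cite: Lieb1980, proof of Theorem 4 (B–B interactions part of H_C)] -/
theorem touchingStrand_eq_onStrand_add_crossingStrand (J : Λ × Λ → ℝ) (s : ℤ × ℤ) :
    touchingStrand J s = onStrand J s + crossingStrand J s := by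
  funext p
  simp only [touchingStrand, onStrand, crossingStrand, Pi.add_apply]
  by_cases h1 : strand p.1 = s <;> by_cases h2 : strand p.2 = s <;> simp [h1, h2]

/-- `touchingStrand + untouchingStrand = J`. [cite: Lieb1980, eqs. (4)–(5) (H_{A+C} = H_A + H_C)] -/
theorem touchingStrand_add_untouchingStrand (J : Λ × Λ → ℝ) (s : ℤ × ℤ) :
    touchingStrand J s + untouchingStrand J s = J := by
  funext p
  simp only [touchingStrand, untouchingStrand, Pi.add_apply]
  split_ifs <;> simp

/-- `onStrand J s ≥ 0` for `J ≥ 0`. [folklore] -/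
private theorem onStrand_nonneg {J : Λ × Λ → ℝ} (hJ : ∀ p, 0 ≤ J p) (s : ℤ × ℤ) (p : Λ × Λ) :
    0 ≤ onStrand J s p := by
  unfold onStrand; split_ifs; exacts [hJ p, le_rfl]

/-- `crossingStrand J s ≥ 0` for `J ≥ 0`. [folklore] -/
private theorem crossingStrand_nonneg {J : Λ × Λ → ℝ} (hJ : ∀ p, 0 ≤ J p) (s : ℤ × ℤ) (p : Λ × Λ) :
    0 ≤ crossingStrand J s p := by
  unfold crossingStrand; split_ifs; exacts [hJ p, le_rfl]

/-- `touchingStrand J s ≥ 0` for `J ≥ 0`. [folklore] -/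
private theorem touchingStrand_nonneg {J : Λ × Λ → ℝ} (hJ : ∀ p, 0 ≤ J p) (s : ℤ × ℤ) (p : Λ × Λ) :
    0 ≤ touchingStrand J s p := by
  unfold touchingStrand; split_ifs; exacts [hJ p, le_rfl]

/-- `untouchingStrand J s ≥ 0` for `J ≥ 0`. [folklore] -/
private theorem untouchingStrand_nonneg {J : Λ × Λ → ℝ} (hJ : ∀ p, 0 ≤ J p) (s : ℤ × ℤ) (p : Λ × Λ) :
    0 ≤ untouchingStrand J s p := by
  unfold untouchingStrand; split_ifs; exacts [le_rfl, hJ p]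

/-- `onStrand J s` is supported on pairs of sites of the strand `s`. [folklore] -/
private theorem onStrand_support (J : Λ × Λ → ℝ) (s : ℤ × ℤ) (p : Λ × Λ) (hp : onStrand J s p ≠ 0) :
    p.1 ∈ univ.filter (fun x : Λ => strand x = s) ∧ p.2 ∈ univ.filter (fun x : Λ => strand x = s) := by
  unfold onStrand at hp
  by_cases h : strand p.1 = s ∧ strand p.2 = s
  · simpa [Finset.mem_filter] using h
  · exact absurd (if_neg h) hp

/-- The **axial foot on the strand `s`** of a site `v`: the site of `Λ` on the strand `s` with the same third
coordinate as `v`, if present, else the default `a₀`. [folklore] -/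
def axialFootAt (Λ : Finset (Site 3)) (s : ℤ × ℤ) (a₀ : Λ) (v : Λ) : Λ :=
  if h : Function.update (Function.update (v : Site 3) 0 s.1) 1 s.2 ∈ Λ then ⟨_, h⟩ else a₀

/-- The double update `(s.1, s.2, v₂)` lies on the strand `s`. [folklore] -/
private theorem strand_update_update (v : Site 3) (s : ℤ × ℤ) :
    ((Function.update (Function.update v 0 s.1) 1 s.2) 0, (Function.update (Function.update v 0 s.1) 1 s.2) 1) = s := by
  ext <;> simp

/-- The foot lies on the strand `s` (when the default does). [folklore] -/
private theorem strand_axialFootAt (s : ℤ × ℤ) {a₀ : Λ} (ha₀ : strand a₀ = s) (v : Λ) :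
    strand (axialFootAt Λ s a₀ v) = s := by
  unfold axialFootAt
  split_ifs with h
  · simp only [strand]
    exact strand_update_update (v : Site 3) s
  · exact ha₀

/-- Two nearest neighbours of `ℤ³` on different strands have the same third coordinate. [folklore] -/
private theorem apply_two_eq_of_nn_of_strand_ne {x y : Site 3} (h1 : l1Norm (x - y) = 1)
    (h2 : ((x 0, x 1) : ℤ × ℤ) ≠ (y 0, y 1)) : x 2 = y 2 := by
  have hsum : (x 0 - y 0).natAbs + (x 1 - y 1).natAbs + (x 2 - y 2).natAbs = 1 := by
    have h := h1
    unfold l1Norm at h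
    rw [Fin.sum_univ_three] at h
    simpa only [Pi.sub_apply] using h
  have h01 : (x 0 - y 0).natAbs + (x 1 - y 1).natAbs ≠ 0 := by
    intro h0
    apply h2
    have ha : (x 0 - y 0).natAbs = 0 := by omega
    have hb : (x 1 - y 1).natAbs = 0 := by omega
    rw [Int.natAbs_eq_zero, sub_eq_zero] at ha hb
    rw [ha, hb]
  have h22 : (x 2 - y 2).natAbs = 0 := by omega
  rwa [Int.natAbs_eq_zero, sub_eq_zero] at h22

/-- A site with third coordinate `z` on the strand `s` IS the double update `(s.1, s.2, z)`. [folklore] -/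
private theorem eq_update_update_of_strand {x v : Site 3} {s : ℤ × ℤ} (hs : ((x 0, x 1) : ℤ × ℤ) = s)
    (hz : x 2 = v 2) : x = Function.update (Function.update v 0 s.1) 1 s.2 := by
  have h0 : x 0 = s.1 := by rw [← hs]
  have h1 : x 1 = s.2 := by rw [← hs]
  funext i
  fin_cases i
  · simp [h0]
  · simp [h1]
  · simp [hz]

/-- Nearest-neighbour strands: a nearest-neighbour bond changes the strand by at most one `ℓ¹` step. [folklore] -/
private theorem strandDist_le_one_of_nn {x y : Λ} (h1 : l1Norm ((x : Site 3) - (y : Site 3)) = 1) :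
    strandDist x y ≤ 1 := by
  have hsum : (((x : Site 3) 0 - (y : Site 3) 0)).natAbs + (((x : Site 3) 1 - (y : Site 3) 1)).natAbs +
      (((x : Site 3) 2 - (y : Site 3) 2)).natAbs = 1 := by
    have h := h1
    unfold l1Norm at h
    rw [Fin.sum_univ_three] at h
    simpa only [Pi.sub_apply] using h
  unfold strandDist strand
  simp only
  omega

/-- For nearest-neighbour couplings the crossing bonds of the strand `s` are **dangling bonds** in the sense of
`twoPoint_add_leaf_eq`: each joins a site `v` off the strand to its axial foot on the strand. [folklore] -/
private theorem crossingStrand_support {J : Λ × Λ → ℝ}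
    (hJnn : ∀ p, J p ≠ 0 → l1Norm ((p.1 : Site 3) - (p.2 : Site 3)) = 1)
    (s : ℤ × ℤ) (a₀ : Λ) (p : Λ × Λ) (hp : crossingStrand J s p ≠ 0) :
    (p.1 ∉ univ.filter (fun x : Λ => strand x = s) ∧ p.2 = axialFootAt Λ s a₀ p.1) ∨
      (p.2 ∉ univ.filter (fun x : Λ => strand x = s) ∧ p.1 = axialFootAt Λ s a₀ p.2) := by
  have hcond : (strand p.1 = s ∧ strand p.2 ≠ s) ∨ (strand p.1 ≠ s ∧ strand p.2 = s) := by
    by_contra h; exact hp (if_neg h)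
  have hJp : J p ≠ 0 := by
    intro h; apply hp; unfold crossingStrand; rw [h, ite_self]
  have hl1 := hJnn p hJp
  simp only [Finset.mem_filter, Finset.mem_univ, true_and]
  rcases hcond with ⟨h1, h2⟩ | ⟨h1, h2⟩
  · -- `p.1` on the strand, `p.2` off: `p.1` is the foot of `p.2`
    right
    refine ⟨h2, ?_⟩
    have hne : (((p.1 : Site 3) 0, (p.1 : Site 3) 1) : ℤ × ℤ) ≠ ((p.2 : Site 3) 0, (p.2 : Site 3) 1) :=
      fun h => h2 (by unfold strand at h1 ⊢; rw [← h]; exact h1)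
    have hz := apply_two_eq_of_nn_of_strand_ne hl1 hne
    have hgeom := eq_update_update_of_strand (v := (p.2 : Site 3)) (s := s) h1 hz
    have hmem : Function.update (Function.update (p.2 : Site 3) 0 s.1) 1 s.2 ∈ Λ := by
      rw [← hgeom]; exact p.1.2
    apply Subtype.ext
    rw [axialFootAt, dif_pos hmem]
    exact hgeom
  · left
    refine ⟨h1, ?_⟩
    have hne : (((p.2 : Site 3) 0, (p.2 : Site 3) 1) : ℤ × ℤ) ≠ ((p.1 : Site 3) 0, (p.1 : Site 3) 1) :=
      fun h => h1 (by unfold strand at h2 ⊢; rw [← h]; exact h2)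
    have hz := apply_two_eq_of_nn_of_strand_ne (by rwa [l1Norm_sub_comm]) hne
    have hgeom := eq_update_update_of_strand (v := (p.1 : Site 3)) (s := s) h2 hz
    have hmem : Function.update (Function.update (p.1 : Site 3) 0 s.1) 1 s.2 ∈ Λ := by
      rw [← hgeom]; exact p.2.2
    apply Subtype.ext
    rw [axialFootAt, dif_pos hmem]
    exact hgeom

variable {β Jp Jz : ℝ}

/-- **Transverse coordination.** For `β, J∥ ≥ 0` and a site `y` on the strand `s`, the crossing couplings at `y`
(both orientations, summed over the volume) total at most `4βJ⊥` — four transverse neighbours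
(`sum_layeredCoupling_le` at `J⊥`-only couplings). [cite: Panis2023Triviality, §1.2.1 (assumption (A2): |J| = sup_x Σ_y J_{x,y})] -/
theorem sum_crossingStrand_le (hβ : 0 ≤ β) (hp : 0 ≤ Jp) (Λ : Finset (Site 3)) {s : ℤ × ℤ} {y : Λ}
    (hy : strand y = s) :
    ∑ b : Λ, (crossingStrand (layeredXYCoupling β Jp Jz Λ) s (b, y) +
        crossingStrand (layeredXYCoupling β Jp Jz Λ) s (y, b)) ≤ 4 * (β * Jp) := by
  -- each crossing coupling at `y` is at most the purely transverse coupling `(β/2)·layeredCoupling J⊥ 0`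
  have htrans : ∀ b : Λ, strand b ≠ s →
      layeredCoupling Jp Jz (b : Site 3) (y : Site 3) ≤ layeredCoupling Jp 0 (b : Site 3) (y : Site 3) := by
    intro b hb
    unfold layeredCoupling
    split_ifs with h1 h2
    · exact le_rfl
    · -- an axial bond (`(b - y) 2 ≠ 0`) between different strands is impossible for nearest neighbours
      exfalso
      have hne : (((b : Site 3) 0, (b : Site 3) 1) : ℤ × ℤ) ≠ ((y : Site 3) 0, (y : Site 3) 1) :=
        fun h => hb (by unfold strand at hy ⊢; rw [h]; exact hy)
      have hz := apply_two_eq_of_nn_of_strand_ne h1 hne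
      exact h2 (by rw [Pi.sub_apply, hz, sub_self])
    · exact le_rfl
  have hb1 : ∀ b : Λ, crossingStrand (layeredXYCoupling β Jp Jz Λ) s (b, y) ≤
      β / 2 * layeredCoupling Jp 0 (y : Site 3) (b : Site 3) := by
    intro b
    unfold crossingStrand
    split_ifs with h
    · have hb : strand b ≠ s := by
        rcases h with ⟨_, h2⟩ | ⟨h1, _⟩
        · exact absurd hy h2
        · exact h1
      unfold layeredXYCoupling
      rw [layeredCoupling_symm (y : Site 3)]
      exact mul_le_mul_of_nonneg_left (htrans b hb) (by positivity)
    · exact mul_nonneg (by positivity) (layeredCoupling_nonneg hp le_rfl _ _)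
  have hb2 : ∀ b : Λ, crossingStrand (layeredXYCoupling β Jp Jz Λ) s (y, b) ≤
      β / 2 * layeredCoupling Jp 0 (y : Site 3) (b : Site 3) := by
    intro b
    unfold crossingStrand
    split_ifs with h
    · have hb : strand b ≠ s := by
        rcases h with ⟨_, h2⟩ | ⟨h1, _⟩
        · exact h2
        · exact absurd hy h1
      unfold layeredXYCoupling
      simp only
      rw [layeredCoupling_symm (y : Site 3) (b : Site 3), layeredCoupling_symm (y : Site 3) (b : Site 3)]
      exact mul_le_mul_of_nonneg_left (htrans b hb) (by positivity)
    · exact mul_nonneg (by positivity) (layeredCoupling_nonneg hp le_rfl _ _)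
  have hsum := sum_layeredCoupling_le hp (le_refl (0 : ℝ)) Λ (y : Site 3)
  rw [← Finset.sum_coe_sort Λ] at hsum
  calc ∑ b : Λ, (crossingStrand (layeredXYCoupling β Jp Jz Λ) s (b, y) +
          crossingStrand (layeredXYCoupling β Jp Jz Λ) s (y, b))
      ≤ ∑ b : Λ, (β / 2 * layeredCoupling Jp 0 (y : Site 3) (b : Site 3) +
          β / 2 * layeredCoupling Jp 0 (y : Site 3) (b : Site 3)) :=
        Finset.sum_le_sum fun b _ => add_le_add (hb1 b) (hb2 b)
    _ = β * ∑ b : Λ, layeredCoupling Jp 0 (y : Site 3) (b : Site 3) := by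
        rw [Finset.mul_sum]
        exact Finset.sum_congr rfl fun b _ => by ring
    _ ≤ β * (4 * Jp + 2 * 0) := mul_le_mul_of_nonneg_left hsum hβ
    _ = 4 * (β * Jp) := by ring

variable [MeasurableSpace Circle] [BorelSpace Circle]

/-- **The one-chain transfer bound.** For the chain array and sites `x` (strand `s`) and `b` (another strand):
`⟨cos(θ_x − θ_b)⟩_{A_s} ≤ ½ ∑_{y ∈ chain s} (D_s(b,y) + D_s(y,b)) ⟨cos(θ_y − θ_x)⟩^{1D}_{chain s}`, `A_s` = the bonds
touching the strand (Lieb's inside system), `D_s` = its crossing bonds, `⟨·⟩^{1D}` = the axial system of the strand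
alone (`twoPoint_add_leaf_le` with the axial feet). [cite: AizenmanSimon1980LocalWard, Thm 3.1 (N = 2)] -/
theorem twoPoint_touchingStrand_le (hβ : 0 ≤ β) (hp : 0 ≤ Jp) (hz : 0 ≤ Jz) (Λ : Finset (Site 3)) (x b : Λ)
    (hb : strand b ≠ strand x) :
    twoPoint (touchingStrand (layeredXYCoupling β Jp Jz Λ) (strand x)) x b ≤
      (1 / 2) * ∑ y ∈ univ.filter (fun y : Λ => strand y = strand x),
        (crossingStrand (layeredXYCoupling β Jp Jz Λ) (strand x) (b, y) +
            crossingStrand (layeredXYCoupling β Jp Jz Λ) (strand x) (y, b)) *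
          twoPoint (onStrand (layeredXYCoupling β Jp Jz Λ) (strand x)) y x := by
  set J := layeredXYCoupling β Jp Jz Λ with hJ
  have hJ0 : ∀ p, 0 ≤ J p := layeredXYCoupling_nonneg hβ hp hz Λ
  rw [touchingStrand_eq_onStrand_add_crossingStrand]
  have hx : x ∈ univ.filter (fun y : Λ => strand y = strand x) := by simp
  have hb' : b ∉ univ.filter (fun y : Λ => strand y = strand x) := by simpa using hb
  exact twoPoint_add_leaf_le (L := univ.filter (fun y : Λ => strand y = strand x))
    (foot := axialFootAt Λ (strand x) x)
    (fun v _ => by simpa using strand_axialFootAt (strand x) (a₀ := x) rfl v) (onStrand_support J (strand x))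
    (crossingStrand_support (layeredXYCoupling_nn Λ) (strand x) x) (onStrand_nonneg hJ0 _)
    (crossingStrand_nonneg hJ0 _) hx hb'

/-- **The Lieb–Rivasseau instance used by the strand decoupling**: with `A` = the strand of `a` and its
neighbouring strands (inside Hamiltonian = the bonds touching the strand of `a`), `C` = the sites off the strand of
`a` and `B = A ∩ C` = the neighbouring strands, the tree's theorem `liebRivasseauInequality_holds` gives, for `c` off
the strand of `a`, `⟨cos(θ_a − θ_c)⟩_Λ ≤ ∑_{b : strandDist b a = 1} ⟨cos(θ_a − θ_b)⟩_{A} ⟨cos(θ_b − θ_c)⟩_Λ`.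
[cite: Lieb1980, eq. (23) and notes added in proof (2)] -/
theorem liebRivasseau_strand (hβ : 0 ≤ β) (hp : 0 ≤ Jp) (hz : 0 ≤ Jz) (Λ : Finset (Site 3)) (a c : Λ)
    (hac : strand a ≠ strand c) :
    twoPoint (layeredXYCoupling β Jp Jz Λ) a c ≤
      ∑ b ∈ univ.filter (fun b : Λ => strandDist b a = 1),
        twoPoint (touchingStrand (layeredXYCoupling β Jp Jz Λ) (strand a)) a b *
          twoPoint (layeredXYCoupling β Jp Jz Λ) b c := by
  set J := layeredXYCoupling β Jp Jz Λ with hJ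
  have hJ0 : ∀ p, 0 ≤ J p := layeredXYCoupling_nonneg hβ hp hz Λ
  set s := strand a with hs
  set A : Finset Λ := univ.filter (fun x : Λ => strandDist x a ≤ 1) with hA
  set C : Finset Λ := univ.filter (fun x : Λ => strand x ≠ s) with hC
  have hJA0 : ∀ p, 0 ≤ touchingStrand J s p := touchingStrand_nonneg hJ0 s
  have hJC0 : ∀ p, 0 ≤ untouchingStrand J s p := untouchingStrand_nonneg hJ0 s
  have hdist0 : ∀ x : Λ, strand x = s → strandDist x a = 0 := fun x hx => by
    unfold strandDist; rw [hx, hs]; simp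
  have hsuppA : ∀ p, touchingStrand J s p ≠ 0 → p.1 ∈ A ∧ p.2 ∈ A := by
    intro p hp0
    have hcond : strand p.1 = s ∨ strand p.2 = s := by by_contra hh; exact hp0 (if_neg hh)
    have hJp : J p ≠ 0 := by intro hh; apply hp0; unfold touchingStrand; rw [hh, ite_self]
    have hd := strandDist_le_one_of_nn (layeredXYCoupling_nn Λ p hJp)
    simp only [hA, Finset.mem_filter, Finset.mem_univ, true_and]
    rcases hcond with h1 | h2
    · refine ⟨(hdist0 _ h1).le.trans zero_le_one, ?_⟩
      -- `strandDist p.2 a ≤ strandDist p.2 p.1 + strandDist p.1 a = strandDist p.1 p.2 + 0`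
      have := hdist0 _ h1
      unfold strandDist at hd this ⊢
      omega
    · refine ⟨?_, (hdist0 _ h2).le.trans zero_le_one⟩
      have := hdist0 _ h2
      unfold strandDist at hd this ⊢
      omega
  have hsuppC : ∀ p, untouchingStrand J s p ≠ 0 → p.1 ∈ C ∧ p.2 ∈ C := by
    intro p hp0
    have hcond : ¬(strand p.1 = s ∨ strand p.2 = s) := by
      intro hh; apply hp0; unfold untouchingStrand; rw [if_pos hh]
    push Not at hcond
    simp only [hC, Finset.mem_filter, Finset.mem_univ, true_and]
    exact hcond
  have ha : a ∈ A := by simp [hA, hdist0 a hs.symm]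
  have hc : c ∈ C := by simpa [hC, hs] using fun hh => hac hh.symm
  have key := liebRivasseauInequality_holds Λ A C (touchingStrand J s) (untouchingStrand J s) hJA0 hJC0 hsuppA
    hsuppC a ha c hc
  rw [touchingStrand_add_untouchingStrand] at key
  have hAC : A ∩ C = univ.filter (fun b : Λ => strandDist b a = 1) := by
    ext b
    simp only [hA, hC, Finset.mem_inter, Finset.mem_filter, Finset.mem_univ, true_and]
    constructor
    · rintro ⟨h1, h2⟩
      have h3 : strandDist b a ≠ 0 := by
        intro h0
        apply h2
        unfold strandDist at h0
        have e1 : (strand b).1 = (strand a).1 := by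
          have : ((strand b).1 - (strand a).1).natAbs = 0 := by omega
          rwa [Int.natAbs_eq_zero, sub_eq_zero] at this
        have e2 : (strand b).2 = (strand a).2 := by
          have : ((strand b).2 - (strand a).2).natAbs = 0 := by omega
          rwa [Int.natAbs_eq_zero, sub_eq_zero] at this
        rw [hs]; exact Prod.ext e1 e2
      omega
    · intro h1
      refine ⟨h1.le, fun hh => ?_⟩
      rw [hdist0 b hh] at h1
      exact absurd h1 (by norm_num)
  rwa [hAC] at key

/-- **Strand decoupling for the XY chain array on `ℤ³` (quasi-one-dimensional ordering lemma).** Let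
`β, Jp, Jz ≥ 0`, `Λ ⊂ ℤ³` finite (free boundary conditions) — the model `layeredXYCoupling β Jp Jz Λ` read as CHAINS
along the stacking axis (coupling `Jz = J∥`) coupled transversely by `Jp = J⊥` — and let `χ` bound the single-chain
susceptibilities: for every site `a`, `∑_{x ∈ chain(a)} ⟨cos(θ_a − θ_x)⟩^{1D}_{chain(a)} ≤ χ`, where `⟨·⟩^{1D}` is the
plane-rotator state of the axial bonds of the strand of `a` ALONE (`onStrand`). Then for all `a, c ∈ Λ`:

  `⟨cos(θ_a − θ_c)⟩_{Λ} ≤ (2βJp·χ)^{d⊥(a,c)}`, `d⊥(a,c) = |a₀ − c₀| + |a₁ − c₁|` the transverse distance.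

So `2βJ⊥χ₁ < 1` forces exponential decay ACROSS the chains, uniformly in the volume: a ceiling `χ₁(T)` on the
one-dimensional susceptibility with `2J⊥χ₁(T) < T` certifies the absence of transverse (hence of any long-range)
order at `T` — `k_BT_c^{q1D-XY}(J∥, J⊥) ≤ inf{T : 2J⊥χ₁(J∥/T) < T}`, which tends to `0` as `J⊥ → 0` since `χ₁` is
finite at every temperature (`PlaneRotatorChainTwoPoint.lean`); with `χ₁ ~ 4J∥/T` this is the Scalapino–Imry–Pincus
scale `k_BT_c ≲ 2√2·√(J∥J⊥)` as a one-sided BOUND (the factor `2 = ½ · 4`: four neighbouring chains, Ward bound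
`u(βJ⊥) ≤ βJ⊥/2` per transverse bond). Lieb–Rivasseau (`liebRivasseau_strand`), the leaf bound
(`twoPoint_touchingStrand_le`), and Simon's iteration in the transverse distance (`decay_of_shellBound`).
[cite: AizenmanSimon1980LocalWard, Thm 3.2 and Remark 4 (mass gap by iteration of a local inequality)] -/
theorem twoPoint_layered_le_pow_transverse (hβ : 0 ≤ β) (hp : 0 ≤ Jp) (hz : 0 ≤ Jz) (Λ : Finset (Site 3))
    {χ : ℝ}
    (hχ : ∀ a : Λ, ∑ x ∈ univ.filter (fun x : Λ => strand x = strand a),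
      twoPoint (onStrand (layeredXYCoupling β Jp Jz Λ) (strand a)) a x ≤ χ)
    (a c : Λ) :
    twoPoint (layeredXYCoupling β Jp Jz Λ) a c ≤ (2 * (β * Jp) * χ) ^ strandDist a c := by
  set J := layeredXYCoupling β Jp Jz Λ with hJ
  have hJ0 : ∀ p, 0 ≤ J p := layeredXYCoupling_nonneg hβ hp hz Λ
  -- the transfer kernel across one strand
  set S : Λ → Λ → ℝ := fun x b =>
    (1 / 2) * ∑ y ∈ univ.filter (fun y : Λ => strand y = strand x),
      (crossingStrand J (strand x) (b, y) + crossingStrand J (strand x) (y, b)) *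
        twoPoint (onStrand J (strand x)) y x with hS
  have hS0 : ∀ x b, 0 ≤ S x b := fun x b =>
    mul_nonneg (by norm_num) (Finset.sum_nonneg fun y _ =>
      mul_nonneg (add_nonneg (crossingStrand_nonneg hJ0 _ _) (crossingStrand_nonneg hJ0 _ _))
        (twoPoint_nonneg (onStrand_nonneg hJ0 _) _ _))
  set κ : Λ → Λ → ℝ := fun x b => if strandDist b x = 1 then S x b else 0 with hκ
  refine decay_of_shellBound (G := fun x => twoPoint J x c) (K := κ) (s := 2 * (β * Jp) * χ)
    (d := fun x => strandDist x c) (fun x => twoPoint_le_one J x c)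
    (fun x b => by simp only [hκ]; split_ifs; exacts [hS0 x b, le_rfl]) ?_ ?_ ?_ a
  · -- row sums: `∑_b κ x b ≤ 2 β J⊥ χ`
    intro x
    have hβp : 0 ≤ 2 * (β * Jp) := by positivity
    calc ∑ b, κ x b ≤ ∑ b, S x b := Finset.sum_le_sum fun b _ => by
            simp only [hκ]; split_ifs; exacts [le_rfl, hS0 x b]
      _ = (1 / 2) * ∑ y ∈ univ.filter (fun y : Λ => strand y = strand x),
            twoPoint (onStrand J (strand x)) y x *
              ∑ b, (crossingStrand J (strand x) (b, y) + crossingStrand J (strand x) (y, b)) := by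
          simp only [hS]
          rw [← Finset.mul_sum, Finset.sum_comm]
          congr 1
          refine Finset.sum_congr rfl fun y _ => ?_
          rw [Finset.mul_sum]
          exact Finset.sum_congr rfl fun b _ => by ring
      _ ≤ (1 / 2) * ∑ y ∈ univ.filter (fun y : Λ => strand y = strand x),
            twoPoint (onStrand J (strand x)) y x * (4 * (β * Jp)) := by
          gcongr with y hy
          · exact twoPoint_nonneg (onStrand_nonneg hJ0 _) _ _
          · exact sum_crossingStrand_le hβ hp Λ (by simpa using hy)
      _ = 2 * (β * Jp) * ∑ y ∈ univ.filter (fun y : Λ => strand y = strand x),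
            twoPoint (onStrand J (strand x)) x y := by
          rw [← Finset.sum_mul]
          rw [show (∑ y ∈ univ.filter (fun y : Λ => strand y = strand x), twoPoint (onStrand J (strand x)) y x) =
              ∑ y ∈ univ.filter (fun y : Λ => strand y = strand x), twoPoint (onStrand J (strand x)) x y from
            Finset.sum_congr rfl fun y _ => twoPoint_comm _ _ _]
          ring
      _ ≤ 2 * (β * Jp) * χ := mul_le_mul_of_nonneg_left (hχ x) hβp
  · -- the transfer step off the strand of `c`: Lieb–Rivasseau, then the leaf bound
    intro x hxc
    have hsx : strand x ≠ strand c := by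
      intro hh; apply hxc
      show strandDist x c = 0
      unfold strandDist; rw [hh]; simp
    refine (liebRivasseau_strand hβ hp hz Λ x c hsx).trans ?_
    rw [Finset.sum_filter]
    refine Finset.sum_le_sum fun b _ => ?_
    split_ifs with h
    · have hb : strand b ≠ strand x := by
        intro hh
        have : strandDist b x = 0 := by unfold strandDist; rw [hh]; simp
        rw [this] at h; exact absurd h (by norm_num)
      simp only [hκ, if_pos h]
      exact mul_le_mul_of_nonneg_right (twoPoint_touchingStrand_le hβ hp hz Λ x b hb) (twoPoint_nonneg hJ0 _ _)
    · simp only [hκ, if_neg h, zero_mul]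
      exact le_rfl
  · -- support: one transverse step at a time (triangle inequality for the strand distance)
    intro x b hxb
    have h : strandDist b x = 1 := by
      by_contra h; exact hxb (by simp only [hκ, if_neg h])
    show strandDist x c ≤ strandDist b c + 1
    unfold strandDist at h ⊢
    omega

end StrandsZ3

end PlaneRotator

end Literature.Probability.LatticeModels
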